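import Mathlib.GroupTheory.PGroup
import Mathlib.GroupTheory.SpecificGroups.Dihedral
import Mathlib.FieldTheory.Finiteness
import Literature.InformationTheory.QuantumCodes.TwoBlockGroupAlgebraCodes
import Summits.Ventures.QEC.Census.BB.TwoGroupPruning
import HarnessLib

/-!
# `2`-group pruning for two-block group-algebra codes over an ARBITRARY finite group

Census fact (LADDER-QEC CENSUS-PREREG v1.6 P3.17, cell A.6′ "2-groups EMPTY BY LEMMA"): if `|G| = 2^r`
and one of the two blocks has ODD weight, the 2BGA code `LP[a,b]` (`H_X = [L(a)|R(b)]`,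
`H_Z = [R(b)ᵀ|L(a)ᵀ]`, `Literature/…/TwoBlockGroupAlgebraCodes.lean`) encodes no qubit: `k = 0`.
The abelian version (`Census/BB/TwoGroupPruning.lean`, commuting Frobenius + Lemma 1) does not transfer;
here is a commutativity-free proof:

* `ker L(a)` is an `𝔽₂`-subspace stable under the RIGHT-regular action `w ↦ w(· g)` of `G` (left and
  right multiplications commute);
* a `2`-group acting on a nonzero `𝔽₂`-space fixes a nonzero vector (orbit counting, Mathlib
  `IsPGroup.exists_fixed_point_of_prime_dvd_card_of_fixed_point`);
* a right-invariant vector is constant, i.e. `𝟙`, and `L(a)𝟙 = |a|·𝟙 ≠ 0` for odd `|a|` — contradiction;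
  so `ker L(a) = 0`, `rank L(a) = |G|`, and `R(b) = (L(b)ᵀ` re-indexed by inversion`)` has the same rank;
* `rank H_X ≥ |G|`, `rank H_Z ≥ |G|` ⇒ `k = 2|G| − rank H_X − rank H_Z = 0`.

Main results: `ker_leftMul_eq_bot_of_odd`, `rank_leftMul_eq_card_of_odd`, `rank_rightMul_eq_card_of_odd`,
**`ga_k_eq_zero_of_card_eq_two_pow`** (any finite group `G` with `|G| = 2^r`, `Odd |a| ∨ Odd |b|`).
All proved; [folklore] (the statement "𝔽₂[G] is local for a finite 2-group" is classical; this file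
proves only what the census needs, in matrix form).
-/

namespace Summit.Ventures.QEC.TwoBlockGA

open Matrix Literature.InformationTheory.QuantumCodes Literature.InformationTheory.QuantumCodes.TwoBlockGA

variable {G : Type*} [Group G] [Fintype G] [DecidableEq G]

/-! ### `L(a)` on the all-ones vector and under right translations -/

omit [DecidableEq G] in
/-- `L(a)·𝟙 = (Σ_g a_g)·𝟙`: every row of `L(a)` is a permutation of `a`. [folklore] -/
theorem leftMul_mulVec_const_one (a : G → ZMod 2) :
    leftMul a *ᵥ (fun _ => (1 : ZMod 2)) = fun _ => ∑ g, a g := by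
  funext α
  simp only [mulVec, dotProduct, leftMul_apply, mul_one]
  exact Fintype.sum_equiv ((Equiv.inv G).trans (Equiv.mulLeft α)) _ _ (fun β => by simp)

omit [DecidableEq G] in
/-- `L(a)` commutes with right translations of the coordinates: `L(a)(w(·g)) = (L(a)w)(·g)`
(because `L(a)R(g) = R(g)L(a)`). [folklore] -/
theorem leftMul_mulVec_comp_mulRight (a : G → ZMod 2) (w : G → ZMod 2) (g : G) :
    leftMul a *ᵥ (fun β => w (β * g)) = fun α => (leftMul a *ᵥ w) (α * g) := by
  funext α
  simp only [mulVec, dotProduct, leftMul_apply]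
  refine Fintype.sum_equiv (Equiv.mulRight g) _ _ (fun β => ?_)
  simp only [Equiv.coe_mulRight]
  congr 2
  group

/-! ### The kernel of an odd-weight `L(a)` over a `2`-group is trivial -/

omit [DecidableEq G] in
/-- **Odd-weight blocks over a `2`-group are injective**: if `G` is a `2`-group and `|a|` is odd then
`ker L(a) = 0`. Proof: `ker L(a)` is stable under the right-regular action; a `2`-group fixes a nonzero
vector of any nonzero `𝔽₂`-representation; a right-invariant vector is the constant `𝟙`; but
`L(a)𝟙 = |a|𝟙 = 𝟙 ≠ 0`. [folklore] -/
theorem ker_leftMul_eq_bot_of_odd (hG : IsPGroup 2 G) (a : G → ZMod 2) (ha : Odd (hammingNorm a)) :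
    LinearMap.ker (leftMul a).mulVecLin = ⊥ := by
  classical
  by_contra hne
  set V : Submodule (ZMod 2) (G → ZMod 2) := LinearMap.ker (leftMul a).mulVecLin with hV
  -- the right-regular action of `G` on `V`
  have hstab : ∀ (g : G) (w : G → ZMod 2), w ∈ V → (fun β => w (β * g)) ∈ V := by
    intro g w hw
    rw [hV, LinearMap.mem_ker, Matrix.mulVecLin_apply] at hw ⊢
    rw [leftMul_mulVec_comp_mulRight, hw]
    rfl
  letI : MulAction G V :=
    { smul := fun g w => ⟨fun β => w.1 (β * g), hstab g w.1 w.2⟩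
      one_smul := fun w => by ext β; change w.1 (β * 1) = w.1 β; rw [mul_one]
      mul_smul := fun g h w => by ext β; change w.1 (β * (g * h)) = w.1 ((β * g) * h); rw [mul_assoc] }
  -- `V` is a nonzero `𝔽₂`-space, so `2 ∣ |V|`
  obtain ⟨v, hvV, hv0⟩ := (Submodule.ne_bot_iff V).1 hne
  have hfr : 0 < Module.finrank (ZMod 2) V :=
    Module.finrank_pos_iff_exists_ne_zero.2 ⟨⟨v, hvV⟩, fun h => hv0 (congrArg Subtype.val h)⟩
  letI : Fintype V := Fintype.ofFinite V
  have hcard : 2 ∣ Nat.card V := by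
    rw [Nat.card_eq_fintype_card, Module.card_eq_pow_finrank (K := ZMod 2) (V := V), ZMod.card]
    exact dvd_pow_self 2 hfr.ne'
  -- a nonzero fixed vector
  have h0 : (0 : V) ∈ MulAction.fixedPoints G V := by
    intro g; ext β; rfl
  obtain ⟨w, hw, hw0⟩ := hG.exists_fixed_point_of_prime_dvd_card_of_fixed_point V hcard h0
  -- it is constant …
  have hconst : ∀ β, w.1 β = w.1 1 := by
    intro β
    have h := congrArg (fun u : V => u.1 1) (hw β)
    change w.1 (1 * β) = w.1 1 at h
    rwa [one_mul] at h
  -- … and nonzero, hence `𝟙`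
  have hw1 : w.1 1 = 1 := by
    have h01 : ∀ x : ZMod 2, x ≠ 0 → x = 1 := by decide
    refine h01 _ fun h => hw0 ?_
    symm; ext β; rw [hconst β, h]; rfl
  have hone : w.1 = fun _ => 1 := funext fun β => by rw [hconst β, hw1]
  -- but `L(a)𝟙 = 𝟙 ≠ 0`
  have hker : leftMul a *ᵥ w.1 = 0 := w.2
  rw [hone, leftMul_mulVec_const_one, AbelianTwoBlock.sum_eq_one_of_odd a ha] at hker
  exact one_ne_zero (congr_fun hker 1)

omit [DecidableEq G] in
/-- Hence `rank L(a) = |G|` for an odd-weight block over a `2`-group. [folklore] -/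
theorem rank_leftMul_eq_card_of_odd (hG : IsPGroup 2 G) (a : G → ZMod 2) (ha : Odd (hammingNorm a)) :
    (leftMul a).rank = Fintype.card G := by
  have h := rank_add_finrank_pcCode (leftMul a)
  rw [pcCode, ker_leftMul_eq_bot_of_odd hG a ha, finrank_bot, add_zero] at h
  exact h

omit [Fintype G] [DecidableEq G] in
/-- `R(b)` is `L(b)ᵀ` re-indexed by inversion: `R(b)_{α,β} = b(β⁻¹α) = L(b)_{β⁻¹,α⁻¹}`. [folklore] -/
theorem rightMul_eq_reindex_transpose_leftMul {R : Type*} (b : G → R) :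
    rightMul b = reindex (Equiv.inv G) (Equiv.inv G) (leftMul b)ᵀ := by
  ext α β
  simp

omit [DecidableEq G] in
/-- So `rank R(b) = |G|` as well for an odd-weight block over a `2`-group. [folklore] -/
theorem rank_rightMul_eq_card_of_odd (hG : IsPGroup 2 G) (b : G → ZMod 2) (hb : Odd (hammingNorm b)) :
    (rightMul b).rank = Fintype.card G := by
  rw [rightMul_eq_reindex_transpose_leftMul, rank_reindex, rank_transpose, rank_leftMul_eq_card_of_odd hG b hb]

/-! ### `k = 0` -/

/-- `rank H_X ≥ rank L(a)` and `rank H_Z ≥ rank L(a)` (`L(a)` is a column block of `H_X`; `L(a)ᵀ` one of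
`H_Z`). [folklore] -/
theorem rank_leftMul_le_rank (a b : G → ZMod 2) :
    (leftMul a).rank ≤ (HX a b).rank ∧ (leftMul a).rank ≤ (HZ a b).rank := by
  constructor
  · have h : leftMul a = HX a b * fromRows (1 : Matrix G G (ZMod 2)) (0 : Matrix G G (ZMod 2)) := by
      rw [HX, fromCols_mul_fromRows, Matrix.mul_one, Matrix.mul_zero, add_zero]
    rw [h]; exact rank_mul_le_left _ _
  · have h : (leftMul a)ᵀ = HZ a b * fromRows (0 : Matrix G G (ZMod 2)) (1 : Matrix G G (ZMod 2)) := by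
      rw [HZ, fromCols_mul_fromRows, Matrix.mul_one, Matrix.mul_zero, zero_add]
    rw [← rank_transpose, h]; exact rank_mul_le_left _ _

/-- `rank H_X ≥ rank R(b)` and `rank H_Z ≥ rank R(b)`. [folklore] -/
theorem rank_rightMul_le_rank (a b : G → ZMod 2) :
    (rightMul b).rank ≤ (HX a b).rank ∧ (rightMul b).rank ≤ (HZ a b).rank := by
  constructor
  · have h : rightMul b = HX a b * fromRows (0 : Matrix G G (ZMod 2)) (1 : Matrix G G (ZMod 2)) := by
      rw [HX, fromCols_mul_fromRows, Matrix.mul_one, Matrix.mul_zero, zero_add]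
    rw [h]; exact rank_mul_le_left _ _
  · have h : (rightMul b)ᵀ = HZ a b * fromRows (1 : Matrix G G (ZMod 2)) (0 : Matrix G G (ZMod 2)) := by
      rw [HZ, fromCols_mul_fromRows, Matrix.mul_one, Matrix.mul_zero, add_zero]
    rw [← rank_transpose, h]; exact rank_mul_le_left _ _

/-- **`2`-GROUP PRUNING, ANY FINITE GROUP**: if `|G| = 2^r` and the block `a` or the block `b` has odd
weight, the two-block group-algebra code `LP[a,b]` over `G` has `k = 0`. Census consequence (A.6′):
every non-abelian (as every abelian) cell of order `8, 16, 32, 64` with `W = 3+3` — indeed any odd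
block weight — is EMPTY a priori. [folklore] -/
theorem ga_k_eq_zero_of_card_eq_two_pow (a b : G → ZMod 2) {r : ℕ}
    (hG : Fintype.card G = 2 ^ r) (hodd : Odd (hammingNorm a) ∨ Odd (hammingNorm b)) :
    (Literature.InformationTheory.QuantumCodes.TwoBlockGA.css (G := G) a b).k = 0 := by
  have hP : IsPGroup 2 G := IsPGroup.of_card (by rw [Nat.card_eq_fintype_card, hG])
  rw [CSSCode.k_eq, css_HX, css_HZ, Fintype.card_sum]
  rcases hodd with ha | hb
  · have h1 := rank_leftMul_le_rank a b
    rw [rank_leftMul_eq_card_of_odd hP a ha] at h1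
    omega
  · have h1 := rank_rightMul_le_rank a b
    rw [rank_rightMul_eq_card_of_odd hP b hb] at h1
    omega

/-- Instance (decidability sanity check on a NON-ABELIAN group): over the dihedral group of order `8`,
the pair `a = δ_1 + δ_r + δ_s` (weight `3`), `b` arbitrary, gives `k = 0`. [folklore] -/
theorem dihedral4_example_k_eq_zero (b : DihedralGroup 4 → ZMod 2) :
    (css (fun g : DihedralGroup 4 => if g = 1 ∨ g = DihedralGroup.r 1 ∨ g = DihedralGroup.sr 0 then 1 else 0) b).k = 0 :=
  ga_k_eq_zero_of_card_eq_two_pow _ _ (r := 3) (by simp [DihedralGroup.card]) (Or.inl (by decide))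

end Summit.Ventures.QEC.TwoBlockGA

/-! ### APPEND 2026-08-27 (qec-type-05 g3): a WEIGHT-ONE block makes `LP[a,b]` trivial over ANY finite
group — the non-abelian form of the «w_A = 1 cells EMPTY BY LEMMA» clause (CENSUS-PREREG P3.15/A.6′):
`L(δ_s)` is the permutation matrix of `β ↦ sβ`, of full rank, so `k = 2|G| − rk H_X − rk H_Z ≤ 0`. -/

namespace Summit.Ventures.QEC.TwoBlockGA

open Matrix Literature.InformationTheory.QuantumCodes Literature.InformationTheory.QuantumCodes.TwoBlockGA

variable {G : Type*} [Group G] [Fintype G] [DecidableEq G]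

omit [Fintype G] in
/-- `L(δ_s)` is the identity matrix with rows re-indexed by `α ↦ s⁻¹α` (a permutation matrix). [folklore] -/
theorem leftMul_single_eq_submatrix_one (s : G) :
    leftMul (Pi.single s (1 : ZMod 2)) =
      (1 : Matrix G G (ZMod 2)).submatrix (Equiv.mulLeft s⁻¹) (Equiv.refl G) := by
  ext α β
  simp only [leftMul_apply, submatrix_apply, Equiv.coe_mulLeft, Equiv.coe_refl, id_eq, one_apply,
    Pi.single_apply]
  congr 1
  refine propext ⟨fun h => ?_, fun h => ?_⟩
  · rw [← h]; group
  · rw [← h]; group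

/-- Hence `rank L(δ_s) = |G|`. [folklore] -/
theorem rank_leftMul_single (s : G) : (leftMul (Pi.single s (1 : ZMod 2))).rank = Fintype.card G := by
  rw [leftMul_single_eq_submatrix_one, rank_submatrix, rank_one]

/-- **A weight-ONE block makes `LP[a,b]` trivial, over ANY finite group**: `|a| = 1` or `|b| = 1` ⇒
`k = 0` (the block is `L(δ_s)` resp. `R(δ_t)`, a permutation matrix; `rk H_X, rk H_Z ≥ |G|`). Census
consequence (A.6′ / A.3s): weight splits `(1, w)` and `(w, 1)` are EMPTY BY LEMMA over every group.
Proved. [folklore] -/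
theorem ga_k_eq_zero_of_hammingNorm_eq_one (a b : G → ZMod 2)
    (h : hammingNorm a = 1 ∨ hammingNorm b = 1) :
    (Literature.InformationTheory.QuantumCodes.TwoBlockGA.css (G := G) a b).k = 0 := by
  rw [CSSCode.k_eq, css_HX, css_HZ, Fintype.card_sum]
  rcases h with ha | hb
  · obtain ⟨s, rfl⟩ := Summit.Ventures.QEC.AbelianTwoBlock.eq_single_of_hammingNorm_eq_one a ha
    have h1 := rank_leftMul_le_rank (Pi.single s (1 : ZMod 2)) b
    rw [rank_leftMul_single] at h1
    omega
  · obtain ⟨t, rfl⟩ := Summit.Ventures.QEC.AbelianTwoBlock.eq_single_of_hammingNorm_eq_one b hb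
    have h1 := rank_rightMul_le_rank a (Pi.single t (1 : ZMod 2))
    rw [rightMul_eq_reindex_transpose_leftMul, rank_reindex, rank_transpose, rank_leftMul_single] at h1
    omega

end Summit.Ventures.QEC.TwoBlockGA
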